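import Summits.ValiantsHypothesis.ValiantsHypothesis.Theorems.KPlusLogSqLawTropicalBThreeFiveBound

/-!
# Route «KPlusLogSqLaw», crux `TropicalB` (stmt-ValiantsHypothesis-19771) — certificate kit for the UNSIGNED `(3,5)` row:
# from a refuted pattern to `n ≤ 33` for dominant chains WITHOUT a sign condition (consecutive terms distinct)

HONEST FRAMING.  Helper toward the registered stubs `stub_tropThin` / `stub_tropFat` of `Cruxes/TropicalB/Lines/birth.lean` (crux
`Summit.ValiantsHypothesis.ValiantsHypothesis.Theses.KPlusLogSqLaw.TropicalB`, item stmt-ValiantsHypothesis-19771; cell `pub-symmetroid`, seat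
val-sym-trop-p3 g10, 2026-08-28; `--supports … --as helper`).  Census bookkeeping far inside the crux's known regime (`m = 3`, `K = 5`); nothing here
bears on `TropicalB` in its window, `WeakLifting`, DoorA26 / DoorA34, `MatrixDescartes` (stmt-ValiantsHypothesis-18050) or VP ≠ VNP.

WHY.  The tree's `(3,5)` row `ThreeFive.tropRootLawAt_three_five : TropRootLawAt 3 5 33` (val-sym-trop-p4 g5, p501835) is stated for
SIGN-ALTERNATING chains, while the cell's counting-tightness threshold `κ(m)` (`…TropicalBTightnessThreshold`, val-sym-trop-p4 g12) is read on the
UNSIGNED row `TropRowD` of `…TropicalBSplitDefs` (dominant chains with consecutive terms distinct, no sign and no `|ε| ≤ 1` condition) — so the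
register stood at `κ(3) ∈ [4, 7]` in the kernel, `= 4` located.  OBSERVATION of this seat: the whole signed proof chain (`…ThreeFiveKit` →
`…ThreeFiveBound` → `…ThreeFiveCert1..6` → `…ThreeFiveTree1/2` → `…ThreeFiveRow`) uses the sign hypothesis ONLY through
`ForbiddenPatterns.exists_pos_of_ge`, and there only to infer that consecutive terms are distinct; the search soundness `ThreeFive.search_sound`
is sign-free.  This file is the unsigned twin of `…ThreeFiveBound` §§3–4 (same statements with the hypothesis
`hne : ∀ k, p k.castSucc ≠ p k.succ` in place of sign alternation); the sequels `…ThreeFiveCertD*`, `…ThreeFiveTreeD*`, `…ThreeFiveRowD`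
re-run the 61 certificates and the 88-leaf tree on it and conclude `TropRowD 3 5 33`, i.e. `κ(3) = 4`.

CONTENT.  `existsD_pos_of_ge` (an unsigned chain with `n ≥ 34` carries all 35 histograms, slopes strictly increasing); `leD_33_of_search`,
`leD_33_of_tie₃` / `leD_33_of_tie₂` / `leD_33_of_tie₃'`, `leD_33_of_search1` — verbatim ports of `le_33_of_search`, `le_33_of_tie₃`,
`le_33_of_tie₂`, `le_33_of_tie₃'`, `le_33_of_search1`.  [this cell; the proofs are val-sym-trop-p4 g5's with the one hypothesis exchanged]
-/

-- `Summit.ValiantsHypothesis.ValiantsHypothesis.…` repeats a component by the D-0017 layout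
-- (single-conjunct summit), which the `dupNamespace` linter flags; the name is mandated.
set_option linter.dupNamespace false
set_option autoImplicit false

namespace Summit.ValiantsHypothesis.ValiantsHypothesis.Theorems.KPlusLogSqLaw

open Summit.ValiantsHypothesis.ValiantsHypothesis.Theorems.MatrixDescartes.Negative
open Summit.ValiantsHypothesis.ValiantsHypothesis.Theorems.LacunarySymmetroidMatrixDescartes.TropicalCensus
open Finset ForbiddenPatterns

namespace ThreeFive

/-! ## 1. An unsigned chain with `34` breakpoints carries every histogram -/

/-- An UNSIGNED dominant chain of a `(3,5)` design (consecutive terms distinct) carries pairwise distinct class multisets (slopes strictly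
increase, `TropicalCensus.slope_lt_of_dominant`); so if it has `n ≥ 34` breakpoints, every class multiset occurs: for each
`s : Sym (Fin 5) 3` some chain position carries it.  [port of `ForbiddenPatterns.exists_pos_of_ge`] -/
theorem existsD_pos_of_ge {d : Fin 5 → ℕ} {v ε : Fin 3 → Fin 3 → Fin 5 → ℤ} {n : ℕ} {θ : Fin (n + 1) → ℤ}
    {p : Fin (n + 1) → Equiv.Perm (Fin 3) × (Fin 3 → Fin 5)} (hθ : StrictMono θ)
    (hdom : ∀ k, IsDominant d v ε (θ k) (p k))
    (hne : ∀ k : Fin n, p k.castSucc ≠ p k.succ) (hn : 34 ≤ n) :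
    (StrictMono fun k => slope d (p k)) ∧ ∀ s : Sym (Fin 5) 3, ∃ k, classSym (p k) = s := by
  have hsm : StrictMono fun k => slope d (p k) := by
    rw [Fin.strictMono_iff_lt_succ]
    intro k
    exact slope_lt_of_dominant d v ε (hθ Fin.castSucc_lt_succ) (hne k) (hdom _) (hdom _)
  have hinj : Function.Injective fun k => classSym (p k) := by
    intro k k' h
    apply hsm.injective
    simp only
    rw [slope_eq_of_classSym, slope_eq_of_classSym]
    exact congrArg (fun M : Sym (Fin 5) 3 => ((M : Multiset (Fin 5)).map fun l => (d l : ℤ)).sum) h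
  have hcard : Fintype.card (Sym (Fin 5) 3) = 35 := by
    rw [Sym.card_sym_eq_multichoose, Fintype.card_fin, Nat.multichoose_eq]
    decide
  have hbij : Function.Bijective fun k => classSym (p k) := by
    rw [Fintype.bijective_iff_injective_and_card]
    refine ⟨hinj, ?_⟩
    have hle := Fintype.card_le_of_injective _ hinj
    rw [Fintype.card_fin] at hle ⊢
    omega
  exact ⟨hsm, hbij.2⟩

/-! ## 2. From a refuted pattern to `n ≤ 33` (unsigned); ties; row relabelling -/

/-- **`n ≤ 33` from a refuted pattern.**  If the search refutes the pattern `pat` (histograms with complete arrangement lists) under relations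
that hold for the strictly increasing exponent vector `d`, and `d` puts the pattern's histograms in increasing slope order, then every
UNSIGNED dominant chain (consecutive terms distinct) of a `(3,5)` design with exponents `d` has at most `33` breakpoints. [this cell; unsigned port of `le_33_of_search`] -/
theorem leD_33_of_search (R2 : Rel2) (R3 : Rel3) (pat : List (Sym (Fin 5) 3 × List (Fin 3 → Fin 5)))
    (hsearch : search R2 R3 [] (pat.map Prod.snd) = true)
    (harr : ∀ q ∈ pat, ∀ c : Fin 3 → Fin 5, (univ.val.map c : Multiset (Fin 5)) = (q.1 : Multiset (Fin 5)) → c ∈ q.2)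
    (d : Fin 5 → ℕ) (hd : StrictMono d)
    (hR2 : ∀ r ∈ R2, d r.1.1 + d r.1.2 < d r.2.1 + d r.2.2)
    (hR3 : ∀ r ∈ R3, d r.1.1 + d r.1.2.1 + d r.1.2.2 < d r.2.1 + d r.2.2.1 + d r.2.2.2)
    (hord : pat.IsChain (fun q q' => symSlope d q.1 < symSlope d q'.1))
    (v ε : Fin 3 → Fin 3 → Fin 5 → ℤ) (n : ℕ) (θ : Fin (n + 1) → ℤ)
    (p : Fin (n + 1) → Equiv.Perm (Fin 3) × (Fin 3 → Fin 5)) (hθ : StrictMono θ)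
    (hdom : ∀ k, IsDominant d v ε (θ k) (p k))
    (hne : ∀ k : Fin n, p k.castSucc ≠ p k.succ) : n ≤ 33 := by
  classical
  by_contra hn
  push Not at hn
  obtain ⟨hsm, hsurj⟩ := existsD_pos_of_ge hθ hdom hne (by omega)
  -- positions of the pattern's histograms
  let pos : Sym (Fin 5) 3 × List (Fin 3 → Fin 5) → Fin (n + 1) := fun q => Classical.choose (hsurj q.1)
  have hpos : ∀ q, classSym (p (pos q)) = q.1 := fun q => Classical.choose_spec (hsurj q.1)
  let fut : List (ℤ × (Equiv.Perm (Fin 3) × (Fin 3 → Fin 5))) := pat.map fun q => (θ (pos q), p (pos q))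
  refine search_sound d v ε R2 R3 hd.monotone hR2 hR3 (pat.map Prod.snd) [] fut (by simpa using hsearch) ?_
    (fun a ha => by simp at ha) (fun f hf => ?_) (fun a ha => by simp at ha) ?_
  · -- class vectors lie in the prescribed arrangement lists
    refine forall₂_map_map _ _ _ pat fun q hq => harr q hq _ ?_
    have := congrArg (fun s : Sym (Fin 5) 3 => (s : Multiset (Fin 5))) (hpos q)
    simpa [classSym] using this
  · obtain ⟨q, -, rfl⟩ := List.mem_map.mp hf
    exact hdom _
  · -- increasing slopes of the pattern ⇒ increasing positions ⇒ increasing parameters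
    have hθlt : ∀ q q', symSlope d q.1 < symSlope d q'.1 → θ (pos q) < θ (pos q') := by
      intro q q' h
      apply hθ
      apply hsm.lt_iff_lt.mp
      show slope d (p (pos q)) < slope d (p (pos q'))
      rw [slope_eq_symSlope, slope_eq_symSlope, hpos, hpos]
      exact h
    have hc : pat.IsChain (fun q q' => θ (pos q) < θ (pos q')) := List.IsChain.imp (fun q q' h => hθlt q q' h) hord
    haveI : Trans (fun q q' : Sym (Fin 5) 3 × List (Fin 3 → Fin 5) => θ (pos q) < θ (pos q'))
        (fun q q' => θ (pos q) < θ (pos q')) (fun q q' => θ (pos q) < θ (pos q')) :=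
      ⟨fun h1 h2 => lt_trans h1 h2⟩
    have hpw : pat.Pairwise (fun q q' => θ (pos q) < θ (pos q')) := hc.pairwise
    exact List.pairwise_map.mpr hpw

/-- **tie of two histograms**: if two distinct class multisets have the same slope, an unsigned dominant chain of a `(3,5)` design has
`n ≤ 33` (its histograms are pairwise distinct with pairwise distinct slopes, so it misses one of the two). [unsigned port of `le_33_of_tie₃`] -/
theorem leD_33_of_tie₃ (x y : Sym (Fin 5) 3) (hxy : x ≠ y) (d : Fin 5 → ℕ) (h : symSlope d x = symSlope d y)
    (v ε : Fin 3 → Fin 3 → Fin 5 → ℤ) (n : ℕ) (θ : Fin (n + 1) → ℤ)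
    (p : Fin (n + 1) → Equiv.Perm (Fin 3) × (Fin 3 → Fin 5)) (hθ : StrictMono θ)
    (hdom : ∀ k, IsDominant d v ε (θ k) (p k))
    (hne : ∀ k : Fin n, p k.castSucc ≠ p k.succ) : n ≤ 33 := by
  by_contra hn
  push Not at hn
  obtain ⟨hsm, hsurj⟩ := existsD_pos_of_ge hθ hdom hne (by omega)
  obtain ⟨kx, hkx⟩ := hsurj x
  obtain ⟨ky, hky⟩ := hsurj y
  have hs : slope d (p kx) = slope d (p ky) := by rw [slope_eq_symSlope, slope_eq_symSlope, hkx, hky, h]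
  have hk : kx = ky := hsm.injective hs
  exact hxy (by rw [← hkx, ← hky, hk])

/-- **tie of two pair sums** `d a + d b = d c + d e` with `{a,b,0} ≠ {c,e,0}`: again `n ≤ 33` (unsigned). [port of `le_33_of_tie₂`] -/
theorem leD_33_of_tie₂ (a b c e : Fin 5)
    (hxy : (⟨{a, b, 0}, by simp⟩ : Sym (Fin 5) 3) ≠ ⟨{c, e, 0}, by simp⟩) (d : Fin 5 → ℕ) (h : d a + d b = d c + d e)
    (v ε : Fin 3 → Fin 3 → Fin 5 → ℤ) (n : ℕ) (θ : Fin (n + 1) → ℤ)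
    (p : Fin (n + 1) → Equiv.Perm (Fin 3) × (Fin 3 → Fin 5)) (hθ : StrictMono θ)
    (hdom : ∀ k, IsDominant d v ε (θ k) (p k))
    (hne : ∀ k : Fin n, p k.castSucc ≠ p k.succ) : n ≤ 33 := by
  refine leD_33_of_tie₃ _ _ hxy d ?_ v ε n θ p hθ hdom hne
  rw [symSlope_mk, symSlope_mk]
  have : (d a : ℤ) + d b = d c + d e := by exact_mod_cast h
  linarith

/-- tie of two triple sums, numeric form (unsigned). [port of `le_33_of_tie₃'`] -/
theorem leD_33_of_tie₃' (a b c a' b' c' : Fin 5)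
    (hxy : (⟨{a, b, c}, by simp⟩ : Sym (Fin 5) 3) ≠ ⟨{a', b', c'}, by simp⟩) (d : Fin 5 → ℕ)
    (h : d a + d b + d c = d a' + d b' + d c')
    (v ε : Fin 3 → Fin 3 → Fin 5 → ℤ) (n : ℕ) (θ : Fin (n + 1) → ℤ)
    (p : Fin (n + 1) → Equiv.Perm (Fin 3) × (Fin 3 → Fin 5)) (hθ : StrictMono θ)
    (hdom : ∀ k, IsDominant d v ε (θ k) (p k))
    (hne : ∀ k : Fin n, p k.castSucc ≠ p k.succ) : n ≤ 33 := by
  refine leD_33_of_tie₃ _ _ hxy d ?_ v ε n θ p hθ hdom hne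
  rw [symSlope_mk, symSlope_mk]
  exact_mod_cast h

/-- **`n ≤ 33` from a pattern refuted by `search1`** (rows relabelled so that the first pattern term carries the identity permutation;
dominance transfers by `isDominant_relabel_iff`) — UNSIGNED chains. [port of `le_33_of_search1`] -/
theorem leD_33_of_search1 (R2 : Rel2) (R3 : Rel3) (pat : List (Sym (Fin 5) 3 × List (Fin 3 → Fin 5)))
    (hsearch : search1 R2 R3 (pat.map Prod.snd) = true)
    (harr : ∀ q ∈ pat, ∀ c : Fin 3 → Fin 5, (univ.val.map c : Multiset (Fin 5)) = (q.1 : Multiset (Fin 5)) → c ∈ q.2)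
    (d : Fin 5 → ℕ) (hd : StrictMono d)
    (hR2 : ∀ r ∈ R2, d r.1.1 + d r.1.2 < d r.2.1 + d r.2.2)
    (hR3 : ∀ r ∈ R3, d r.1.1 + d r.1.2.1 + d r.1.2.2 < d r.2.1 + d r.2.2.1 + d r.2.2.2)
    (hord : pat.IsChain (fun q q' => symSlope d q.1 < symSlope d q'.1))
    (v ε : Fin 3 → Fin 3 → Fin 5 → ℤ) (n : ℕ) (θ : Fin (n + 1) → ℤ)
    (p : Fin (n + 1) → Equiv.Perm (Fin 3) × (Fin 3 → Fin 5)) (hθ : StrictMono θ)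
    (hdom : ∀ k, IsDominant d v ε (θ k) (p k))
    (hne : ∀ k : Fin n, p k.castSucc ≠ p k.succ) : n ≤ 33 := by
  classical
  by_contra hn
  push Not at hn
  obtain ⟨hsm, hsurj⟩ := existsD_pos_of_ge hθ hdom hne (by omega)
  let pos : Sym (Fin 5) 3 × List (Fin 3 → Fin 5) → Fin (n + 1) := fun q => Classical.choose (hsurj q.1)
  have hpos : ∀ q, classSym (p (pos q)) = q.1 := fun q => Classical.choose_spec (hsurj q.1)
  -- the pattern is nonempty (else `search1 = false`)
  obtain ⟨q₀, pat', rfl⟩ : ∃ q₀ pat', pat = q₀ :: pat' := by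
    cases pat with
    | nil => simp [search1] at hsearch
    | cons q₀ pat' => exact ⟨q₀, pat', rfl⟩
  -- relabel the rows by the permutation of the first pattern term
  set π : Equiv.Perm (Fin 3) := (p (pos q₀)).1 with hπ
  let v' : Fin 3 → Fin 3 → Fin 5 → ℤ := fun a b l => v (π a) b l
  let ε' : Fin 3 → Fin 3 → Fin 5 → ℤ := fun a b l => ε (π a) b l
  let p' : Fin (n + 1) → Equiv.Perm (Fin 3) × (Fin 3 → Fin 5) := fun k => (π⁻¹ * (p k).1, (p k).2)
  have hdom' : ∀ k, IsDominant d v' ε' (θ k) (p' k) := by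
    intro k
    have h := (isDominant_relabel_iff d v ε π 1 (π⁻¹ * (p k).1, (p k).2) (θ k)).mp
    have e : ((π * (π⁻¹ * (p k).1) * (1 : Equiv.Perm (Fin 3))⁻¹ : Equiv.Perm (Fin 3)),
        fun j => (p k).2 (((1 : Equiv.Perm (Fin 3))⁻¹) j)) = p k := by
      ext1
      · ext1 x; simp
      · funext j; simp
    rw [e] at h
    simpa [v', ε'] using h (hdom k)
  let fut : List (ℤ × (Equiv.Perm (Fin 3) × (Fin 3 → Fin 5))) := pat'.map fun q => (θ (pos q), p' (pos q))
  let f₀ : ℤ × (Equiv.Perm (Fin 3) × (Fin 3 → Fin 5)) := (θ (pos q₀), p' (pos q₀))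
  -- unpack `search1`
  have hs1 : search R2 R3 [(![0, 1, 2], (p (pos q₀)).2)] (pat'.map Prod.snd) = true := by
    simp only [search1, List.map_cons, List.all_eq_true] at hsearch
    refine hsearch _ (harr q₀ (List.mem_cons_self) _ ?_)
    have := congrArg (fun s : Sym (Fin 5) 3 => (s : Multiset (Fin 5))) (hpos q₀)
    simpa [classSym] using this
  have habs : [(![0, 1, 2], (p (pos q₀)).2)] = [f₀].map fun a => abs a.2 := by
    simp only [List.map_cons, List.map_nil, abs, f₀, p']
    rw [hπ, inv_mul_cancel, coe_one_eq]
  rw [habs] at hs1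
  have hθlt : ∀ q q', symSlope d q.1 < symSlope d q'.1 → θ (pos q) < θ (pos q') := by
    intro q q' h
    apply hθ
    apply hsm.lt_iff_lt.mp
    show slope d (p (pos q)) < slope d (p (pos q'))
    rw [slope_eq_symSlope, slope_eq_symSlope, hpos, hpos]
    exact h
  have hc : (q₀ :: pat').IsChain (fun q q' => θ (pos q) < θ (pos q')) := List.IsChain.imp (fun q q' h => hθlt q q' h) hord
  haveI : Trans (fun q q' : Sym (Fin 5) 3 × List (Fin 3 → Fin 5) => θ (pos q) < θ (pos q'))
      (fun q q' => θ (pos q) < θ (pos q')) (fun q q' => θ (pos q) < θ (pos q')) :=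
    ⟨fun h1 h2 => lt_trans h1 h2⟩
  have hpw : (q₀ :: pat').Pairwise (fun q q' => θ (pos q) < θ (pos q')) := hc.pairwise
  refine search_sound d v' ε' R2 R3 hd.monotone hR2 hR3 (pat'.map Prod.snd) [f₀] fut hs1 ?_ ?_ ?_ ?_ ?_
  · refine forall₂_map_map _ _ _ pat' fun q hq => harr q (List.mem_cons_of_mem _ hq) _ ?_
    have := congrArg (fun s : Sym (Fin 5) 3 => (s : Multiset (Fin 5))) (hpos q)
    simpa [classSym] using this
  · intro a ha
    rw [List.mem_singleton] at ha
    subst ha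
    exact hdom' _
  · intro f hf
    obtain ⟨q, -, rfl⟩ := List.mem_map.mp hf
    exact hdom' _
  · intro a ha f hf
    rw [List.mem_singleton] at ha
    subst ha
    obtain ⟨q, hq, rfl⟩ := List.mem_map.mp hf
    exact List.rel_of_pairwise_cons hpw hq
  · exact List.pairwise_map.mpr hpw.of_cons

end ThreeFive

end Summit.ValiantsHypothesis.ValiantsHypothesis.Theorems.KPlusLogSqLaw
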